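import Summits.ResolutionOfSingularities.ResolutionOfSingularities.Theorems.EquisingularLiftEquisingularLiftNatSpecimenWhitneyCubicCharts
import Summits.ResolutionOfSingularities.ResolutionOfSingularities.Theorems.EquisingularLiftEquisingularLiftNatLinearCentrePoints
import Summits.ResolutionOfSingularities.ResolutionOfSingularities.Theorems.EquisingularLiftEquisingularLiftStrictTransformBlowupModel
import Summits.ResolutionOfSingularities.ResolutionOfSingularities.Theorems.EquisingularLiftEquisingularLiftLinearCentreOfCharts
import Literature.AlgebraicGeometry.Resolution.EmbeddedResolutionCentre
import Literature.AlgebraicGeometry.Resolution.AffineBlowupIntegral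
import Literature.AlgebraicGeometry.Resolution.BlowupsExistence
import Literature.AlgebraicGeometry.Motives.ProjectiveSpaceLinearSubspaces
import Mathlib.LinearAlgebra.Matrix.Determinant.Basic
import HarnessLib

/-!
# [OURS · L1 W4.5(b)] R2 specimen (WHITNEY-TYPE CUBIC `x₁x₂² = x₀x₃²`) satisfies the downstairs hypothesis of the REGISTERED stub
# `stub_elnat_ciNoseThenPoints` with a CURVE `Σ` — the double line `V(x₂, x₃)`, zero point steps: a second NON-VACUITY certificate
# (crux `EquisingularLiftNat`, stmt-ResolutionOfSingularities-20038 / child stmt-20148; skeleton v6 of res-L1-w45b-lead-2, TARGET-CINOSE 9810b78bf486e457)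

NOT a statement of any manuscript; OURS kernel certificate (cell `res-hironaka`, chain w45b; seat res-D-pv-013, own initiative, counted 0;
the specimen and its downstairs regularity are res-D-pv-022's R2 files p505461 · p507017 · p508519 · p511043). AI-written, weaker than
expert review.

For `H = V₊(x₁x₂² − x₀x₃²) ⊂ ℙ³_k` (ANY field `k`; `…WhitneyCubicForms/Charts`) the DOWNSTAIRS hypothesis of `stub_elnat_ciNoseThenPoints`
(VERBATIM at `n = 3`) holds with a ONE-DIMENSIONAL complete intersection:

* `c = 2`, `f = (x₂, x₃)`, degrees `(1, 1)` — `Σ = {y | x₂, x₃ ∈ 𝔭_y}` is the double LINE `V(x₂, x₃) = Sing H`: nonempty (its generic point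
  `coordSubspacePoint {2,3}`), `Σ ⊆ ι(H)` (`F ∈ (x₂, x₃)`), `ι(H) ⊄ Σ` (`x₂ ∉ (F)`, pv-022), Jacobian minor for `e = (2, 3)` is `det 1 = 1`;
* `υ` a blow-up of `ℙ³_k` along `𝓘(Σ)`, which EQUALS pv-022's kill-map centre `Λ = ker Proj(f_k)` (`r = 1`, `m = 2`):
  `range Proj(f_k) = Σ` (the generic point `(0) ∈ ℙ¹_k` maps to the generic point of the line, whose closure is `Σ`) and
  `ker = 𝓘(closure range)` for the reduced source (tree `ker_eq_vanishingIdeal_of_isReduced`);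
* ZERO point steps: `V(closure υ⁻¹(ι(H) ∖ Σ))_red` is a blow-up of `H` along `Λ · 𝒪_H` (tree `LinearCentre.isRegular_reducedStrictTransform_of_blowupModel`)
  hence regular by pv-022's `WhitneyCubic.isRegular_of_isBlowup_comap`.

Together with `FermatCone.ciNoseThenPoints_hypothesis_fermatCone` (p519455, `Σ` a point) this certifies the registered stub's hypothesis is met by
both shapes of `Σ` it is designed for (isolated points and double curves); composed with the stub's closure (CI-INST: pv-027 T-LIFT-CI ∘ res-type-051)
it re-derives `WhitneyCubic.elNatAt_whitneyCubic`.
-/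

set_option linter.dupNamespace false -- mandated namespace `Summit.<Summit>.<Problem>` of this single-conjunct summit

noncomputable section

open CategoryTheory CategoryTheory.Limits AlgebraicGeometry TopologicalSpace
open MvPolynomial HomogeneousLocalization
open Literature.AlgebraicGeometry.Resolution
open Literature.AlgebraicGeometry.Motives Literature.AlgebraicGeometry.Motives.SmoothHypersurface
open Literature.AlgebraicGeometry.Motives.ProjectiveSpace
open AlgebraicGeometry.Scheme.IdealSheafData

namespace Summit.ResolutionOfSingularities.ResolutionOfSingularities.Cruxes.EquisingularLiftNat.Sections

namespace WhitneyCubic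

variable (k : Type) [Field k]

attribute [local instance] MvPolynomial.gradedAlgebra ProjBaseChange.algebraBase

/-! ## The double line `Σ = {y | x₂, x₃ ∈ 𝔭_y}` -/

/-- `Σ = {y | x₂, x₃ ∈ 𝔭_y}` is the zero locus `V₊(x₂, x₃)`. [folklore] -/
theorem doubleLine_eq_zeroLocus :
    {y : (Literature.AlgebraicGeometry.Motives.projectiveSpace 3 k).left |
      ∀ i, (![X 2, X 3] : Fin 2 → MvPolynomial (Fin (3 + 1)) k) i ∈
        (y : ProjectiveSpectrum (MvPolynomial.homogeneousSubmodule (Fin (3 + 1)) k)).asHomogeneousIdeal} =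
      ProjectiveSpectrum.zeroLocus (MvPolynomial.homogeneousSubmodule (Fin (3 + 1)) k)
        (X '' ((({2, 3} : Finset (Fin (3 + 1))) : Set (Fin (3 + 1))))) := by
  ext y
  refine Iff.trans ?_ (ProjectiveSpectrum.mem_zeroLocus _ _ _).symm
  rw [Set.image_subset_iff]
  simp only [Finset.coe_insert, Finset.coe_singleton, Fin.forall_fin_succ, IsEmpty.forall_iff, Matrix.cons_val_zero,
    Matrix.cons_val_succ, and_true, Set.insert_subset_iff, Set.singleton_subset_iff, Set.mem_preimage, SetLike.mem_coe,
    Set.mem_setOf_eq]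

/-- `Σ` is closed. [folklore] -/
theorem isClosed_doubleLine :
    IsClosed {y : (Literature.AlgebraicGeometry.Motives.projectiveSpace 3 k).left |
      ∀ i, (![X 2, X 3] : Fin 2 → MvPolynomial (Fin (3 + 1)) k) i ∈
        (y : ProjectiveSpectrum (MvPolynomial.homogeneousSubmodule (Fin (3 + 1)) k)).asHomogeneousIdeal} := by
  rw [doubleLine_eq_zeroLocus]
  exact ProjectiveSpectrum.isClosed_zeroLocus _ _

/-- The proper subset `{2, 3}` of the coordinates. [folklore] -/
theorem finset_two_three_ne_univ : ({2, 3} : Finset (Fin (3 + 1))) ≠ Finset.univ := by decide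

/-- `Σ` is the closure of the generic point `(x₂, x₃)` of the line (`coordSubspacePoint`). [folklore] -/
theorem doubleLine_eq_closure_genericPoint :
    {y : (Literature.AlgebraicGeometry.Motives.projectiveSpace 3 k).left |
      ∀ i, (![X 2, X 3] : Fin 2 → MvPolynomial (Fin (3 + 1)) k) i ∈
        (y : ProjectiveSpectrum (MvPolynomial.homogeneousSubmodule (Fin (3 + 1)) k)).asHomogeneousIdeal} =
      closure {coordSubspacePoint (k := k) ({2, 3} : Finset (Fin (3 + 1))) (finset_two_three_ne_univ)} := by
  rw [doubleLine_eq_zeroLocus, closure_coordSubspacePoint]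

/-- The generic point of the line lies in `Σ`; in particular `Σ` is nonempty. [folklore] -/
theorem genericPoint_mem_doubleLine :
    coordSubspacePoint (k := k) ({2, 3} : Finset (Fin (3 + 1))) finset_two_three_ne_univ ∈
      {y : (Literature.AlgebraicGeometry.Motives.projectiveSpace 3 k).left |
      ∀ i, (![X 2, X 3] : Fin 2 → MvPolynomial (Fin (3 + 1)) k) i ∈
        (y : ProjectiveSpectrum (MvPolynomial.homogeneousSubmodule (Fin (3 + 1)) k)).asHomogeneousIdeal} := by
  rw [doubleLine_eq_closure_genericPoint]
  exact subset_closure rfl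

/-! ## `Σ` is the support of pv-022's kill-map centre `Λ = ker Proj(f_k)` (`r = 1`, `m = 2`), and `Λ = 𝓘(Σ)` -/

section Kill

variable (fk : homogeneousSubmodule (Fin (1 + 2 + 1)) k →+*ᵍ homogeneousSubmodule (Fin (1 + 1)) k)
  (hfk' : HomogeneousIdeal.irrelevant (homogeneousSubmodule (Fin (1 + 1)) k) ≤
    (HomogeneousIdeal.irrelevant (homogeneousSubmodule (Fin (1 + 2 + 1)) k)).map fk) (hfkC : ∀ a : k, fk (C a) = C a)
  (hfkX : ∀ i : Fin (1 + 2 + 1), fk (X i) = if h : (i : ℕ) < 1 + 1 then X ⟨i, h⟩ else 0)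

include hfkC hfkX in
/-- `range Proj(f_k) ⊆ Σ`: the killed variables `x₂, x₃` vanish on the image. [folklore] -/
theorem range_projMap_kill_subset_doubleLine :
    Set.range (Proj.map fk hfk') ⊆
      {y : (Literature.AlgebraicGeometry.Motives.projectiveSpace 3 k).left |
      ∀ i, (![X 2, X 3] : Fin 2 → MvPolynomial (Fin (3 + 1)) k) i ∈
        (y : ProjectiveSpectrum (MvPolynomial.homogeneousSubmodule (Fin (3 + 1)) k)).asHomogeneousIdeal} := by
  intro y hy
  have hy' := (Proj.map fk hfk').range_subset_ker_support hy
  have h2 := X_mem_of_mem_support k fk hfk' hfkC hfkX hy' 2 (by decide)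
  have h3 := X_mem_of_mem_support k fk hfk' hfkC hfkX hy' 3 (by decide)
  intro i
  fin_cases i
  · exact h2
  · exact h3

include hfkC hfkX in
/-- **The generic point of the line is the image of the generic point of `ℙ¹_k`**: `Proj(f_k)` takes `(0) ∈ Proj k[x₀, x₁]` to the point
`(x₂, x₃) = ker f_k` of `ℙ³_k`. [folklore] -/
theorem genericPoint_mem_range_projMap_kill :
    coordSubspacePoint (k := k) ({2, 3} : Finset (Fin (3 + 1))) finset_two_three_ne_univ ∈ Set.range (Proj.map fk hfk') := by
  -- the generic point of `ℙ¹_k = Proj k[x₀, x₁]`: the zero ideal (prime, homogeneous, relevant since `x₀ ∉ (0)`)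
  let y₀ : Proj (homogeneousSubmodule (Fin (1 + 1)) k) :=
    ⟨⊥, Ideal.isPrime_bot, fun h => by
      have hX : (X 0 : MvPolynomial (Fin (1 + 1)) k) ∈ HomogeneousIdeal.irrelevant (homogeneousSubmodule (Fin (1 + 1)) k) :=
        HomogeneousIdeal.mem_irrelevant_of_mem _ zero_lt_one
          (EquisingularLift.StrataSplit.LinearCentre.X_mem_one (r := 1) (m := 0) 0)
      have h0 : (X 0 : MvPolynomial (Fin (1 + 1)) k) ∈ (⊥ : HomogeneousIdeal (homogeneousSubmodule (Fin (1 + 1)) k)) := h hX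
      rw [← HomogeneousIdeal.mem_iff, HomogeneousIdeal.toIdeal_bot, Ideal.mem_bot] at h0
      exact X_ne_zero (R := k) (0 : Fin (1 + 1)) h0⟩
  refine ⟨y₀, ?_⟩
  apply ProjectiveSpectrum.ext
  apply HomogeneousIdeal.toIdeal_injective
  rw [LinearCentre.projMap_apply_asHomogeneousIdeal, HomogeneousIdeal.toIdeal_comap, toIdeal_coordSubspacePoint]
  change Ideal.comap fk.toRingHom ⊥ = _
  rw [← RingHom.ker_eq_comap_bot,
    EquisingularLift.StrataSplit.LinearCentre.ker_kill (r := 1) (m := 2) fk.toRingHom (fun a => hfkC a) (fun i => hfkX i)]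
  have hidx : {i : Fin (1 + 2 + 1) | 1 + 1 ≤ (i : ℕ)} = ((({2, 3} : Finset (Fin (3 + 1))) : Set (Fin (3 + 1)))) := by
    ext i
    fin_cases i <;> simp
  rw [hidx]

include hfkC hfkX in
/-- **`range Proj(f_k) = Σ`**: the image is closed and contains the generic point of the line, whose closure is `Σ`. [folklore] -/
theorem range_projMap_kill_eq_doubleLine :
    Set.range (Proj.map fk hfk') =
      {y : (Literature.AlgebraicGeometry.Motives.projectiveSpace 3 k).left |
      ∀ i, (![X 2, X 3] : Fin 2 → MvPolynomial (Fin (3 + 1)) k) i ∈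
        (y : ProjectiveSpectrum (MvPolynomial.homogeneousSubmodule (Fin (3 + 1)) k)).asHomogeneousIdeal} := by
  haveI : IsClosedImmersion (Proj.map fk hfk') :=
    Literature.AlgebraicGeometry.FundamentalGroup.isClosedImmersion_projMap_of_surjective fk hfk'
      (EquisingularLift.StrataSplit.LinearCentre.kill_surjective (r := 1) (m := 2) fk.toRingHom (fun a => hfkC a)
        (fun i => hfkX i))
  refine (range_projMap_kill_subset_doubleLine k fk hfk' hfkC hfkX).antisymm fun y hy => ?_
  have hy' := ((Set.ext_iff.mp (doubleLine_eq_closure_genericPoint k)) y).mp hy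
  exact closure_minimal (Set.singleton_subset_iff.mpr (genericPoint_mem_range_projMap_kill k fk hfk' hfkC hfkX))
    (Proj.map fk hfk').isClosedEmbedding.isClosed_range hy'

include hfkC hfkX in
/-- `supp Λ = Σ` for `Λ = ker Proj(f_k)`. [folklore] -/
theorem support_ker_projMap_kill_eq_doubleLine :
    ((Proj.map fk hfk').ker.support : Set (Proj (homogeneousSubmodule (Fin (1 + 2 + 1)) k))) =
      {y : (Literature.AlgebraicGeometry.Motives.projectiveSpace 3 k).left |
      ∀ i, (![X 2, X 3] : Fin 2 → MvPolynomial (Fin (3 + 1)) k) i ∈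
        (y : ProjectiveSpectrum (MvPolynomial.homogeneousSubmodule (Fin (3 + 1)) k)).asHomogeneousIdeal} := by
  rw [Scheme.Hom.support_ker, range_projMap_kill_eq_doubleLine k fk hfk' hfkC hfkX]
  exact (isClosed_doubleLine k).closure_eq

include hfkC hfkX in
/-- **`Λ = ker Proj(f_k)` IS the vanishing ideal sheaf of `Σ`** (the source `ℙ¹_k` is reduced: tree `ker_eq_vanishingIdeal_of_isReduced`;
the closure of the image is `Σ`). [folklore] -/
theorem ker_projMap_kill_eq_vanishingIdeal_doubleLine
    (hS : IsClosed {y : (Literature.AlgebraicGeometry.Motives.projectiveSpace 3 k).left |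
      ∀ i, (![X 2, X 3] : Fin 2 → MvPolynomial (Fin (3 + 1)) k) i ∈
        (y : ProjectiveSpectrum (MvPolynomial.homogeneousSubmodule (Fin (3 + 1)) k)).asHomogeneousIdeal}) :
    (Proj.map fk hfk').ker = vanishingIdeal ⟨_, hS⟩ := by
  haveI : IsReduced (Proj (homogeneousSubmodule (Fin (1 + 1)) k)) := Proj.isReduced _
  rw [ker_eq_vanishingIdeal_of_isReduced]
  congr 1
  apply Closeds.ext
  change closure (Set.range (Proj.map fk hfk')) = _
  rw [range_projMap_kill_eq_doubleLine k fk hfk' hfkC hfkX]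
  exact hS.closure_eq

end Kill

/-! ## The remaining clauses of the hypothesis -/

/-- `Σ ⊆ ι(H)`: `F = x₁x₂² − x₀x₃² ∈ 𝔭_y` whenever `x₂, x₃ ∈ 𝔭_y`. [folklore] -/
theorem doubleLine_subset_range_ι :
    {y : (Literature.AlgebraicGeometry.Motives.projectiveSpace 3 k).left |
      ∀ i, (![X 2, X 3] : Fin 2 → MvPolynomial (Fin (3 + 1)) k) i ∈
        (y : ProjectiveSpectrum (MvPolynomial.homogeneousSubmodule (Fin (3 + 1)) k)).asHomogeneousIdeal} ⊆
      Set.range (hypersurfaceι (form k)).left := by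
  intro y hy
  have h2 : (X 2 : MvPolynomial (Fin (3 + 1)) k) ∈ y.asHomogeneousIdeal := hy 0
  have h3 : (X 3 : MvPolynomial (Fin (3 + 1)) k) ∈ y.asHomogeneousIdeal := hy 1
  refine (Set.ext_iff.mp (range_hypersurfaceι (form k)) y).mpr
    ((ProjectiveSpectrum.mem_zeroLocus _ _ _).mpr (Set.singleton_subset_iff.mpr ?_))
  change form k ∈ y.asHomogeneousIdeal
  rw [form]
  exact Ideal.sub_mem _ (Ideal.mul_mem_left _ _ (Ideal.pow_mem_of_mem _ h2 2 two_pos))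
    (Ideal.mul_mem_left _ _ (Ideal.pow_mem_of_mem _ h3 2 two_pos))

/-- `ι(H) ⊄ Σ`: the generic point `(F)` of `H` does not contain `x₂` (pv-022's `X_two_not_mem_span_form`). [folklore] -/
theorem not_range_ι_subset_doubleLine :
    ¬ (Set.range (hypersurfaceι (form k)).left ⊆
      {y : (Literature.AlgebraicGeometry.Motives.projectiveSpace 3 k).left |
      ∀ i, (![X 2, X 3] : Fin 2 → MvPolynomial (Fin (3 + 1)) k) i ∈
        (y : ProjectiveSpectrum (MvPolynomial.homogeneousSubmodule (Fin (3 + 1)) k)).asHomogeneousIdeal}) := by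
  intro h
  have hmem : (pointOfPrime (form k) (isHomogeneous_form k) (prime_form k) :
      Proj (homogeneousSubmodule (Fin (3 + 1)) k)) ∈ Set.range (hypersurfaceι (form k)).left := by
    refine (Set.ext_iff.mp (range_hypersurfaceι (form k)) _).mpr
      ((ProjectiveSpectrum.mem_zeroLocus _ _ _).mpr (Set.singleton_subset_iff.mpr ?_))
    exact Ideal.subset_span rfl
  have h2 : (X 2 : MvPolynomial (Fin 4) k) ∈ Ideal.span {form k} := (h hmem) 0
  exact X_two_not_mem_span_form k h2

/-- **The Jacobian clause**: with `e = (2, 3) : Fin 2 ↪ Fin 4` the minor `(∂x_{e i}/∂x_{e j})` is the identity matrix, whose determinant `1`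
lies in no point's (proper) ideal. [folklore] -/
theorem jacobian_clause_doubleLine (y : (Literature.AlgebraicGeometry.Motives.projectiveSpace 3 k).left) :
    ∃ e : Fin 2 ↪ Fin (3 + 1), Matrix.det (Matrix.of fun i j =>
      MvPolynomial.pderiv (e j) ((![X 2, X 3] : Fin 2 → MvPolynomial (Fin (3 + 1)) k) i)) ∉
        (y : ProjectiveSpectrum (MvPolynomial.homogeneousSubmodule (Fin (3 + 1)) k)).asHomogeneousIdeal := by
  refine ⟨⟨![2, 3], by decide⟩, ?_⟩
  have hM : (Matrix.of fun i j : Fin 2 =>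
      MvPolynomial.pderiv ((⟨![2, 3], by decide⟩ : Fin 2 ↪ Fin (3 + 1)) j)
        ((![X 2, X 3] : Fin 2 → MvPolynomial (Fin (3 + 1)) k) i)) = 1 := by
    ext i j
    fin_cases i <;> fin_cases j <;> simp [pderiv_X]
  rw [hM, Matrix.det_one]
  exact fun h1 => y.isPrime.ne_top ((Ideal.eq_top_iff_one _).mpr h1)

/-! ## The certificate -/

/-- **THE WHITNEY-TYPE CUBIC SATISFIES THE DOWNSTAIRS HYPOTHESIS OF `stub_elnat_ciNoseThenPoints` AT `n = 3` WITH A CURVE `Σ`** (any field `K`):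
the `∃ (c, f, d, …)` block of the registered stub (TARGET-CINOSE 9810b78bf486e457, skeleton v6) for `H = V₊(x₁x₂² − x₀x₃²)`, `ι = hypersurfaceι F`,
witnessed by `c = 2`, `f = (x₂, x₃)`, degrees `(1,1)` (`Σ` = the double line), a blow-up `υ` of `ℙ³_K` along `𝓘(Σ) = ker Proj(f_K)`, and ZERO
point steps — the reduced strict transform `V(closure υ⁻¹(ι(H) ∖ Σ))_red` is a blow-up of `H` along `Λ · 𝒪_H` (tree
`isRegular_reducedStrictTransform_of_blowupModel`), hence regular by pv-022's `isRegular_of_isBlowup_comap`. Non-vacuity certificate for the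
registered stub with a one-dimensional `Σ`. [OURS · L1 W4.5b] [folklore] -/
theorem ciNoseThenPoints_hypothesis_whitneyCubic (K : Type) [Field K] :
    (letI := MvPolynomial.gradedAlgebra (σ := Fin (3 + 1)) (R := K); ∃ (c : ℕ) (f : Fin c → MvPolynomial (Fin (3 + 1)) K) (d : Fin c → ℕ), (∀ i, 1 ≤ d i ∧ f i ∈ MvPolynomial.homogeneousSubmodule (Fin (3 + 1)) K (d i)) ∧ Set.Nonempty {y : (Literature.AlgebraicGeometry.Motives.projectiveSpace 3 K).left | ∀ i, f i ∈ (y : ProjectiveSpectrum (MvPolynomial.homogeneousSubmodule (Fin (3 + 1)) K)).asHomogeneousIdeal} ∧ {y : (Literature.AlgebraicGeometry.Motives.projectiveSpace 3 K).left | ∀ i, f i ∈ (y : ProjectiveSpectrum (MvPolynomial.homogeneousSubmodule (Fin (3 + 1)) K)).asHomogeneousIdeal} ⊆ Set.range (Literature.AlgebraicGeometry.Motives.SmoothHypersurface.hypersurfaceι (WhitneyCubic.form K)).left ∧ ¬ (Set.range (Literature.AlgebraicGeometry.Motives.SmoothHypersurface.hypersurfaceι (WhitneyCubic.form K)).left ⊆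 {y : (Literature.AlgebraicGeometry.Motives.projectiveSpace 3 K).left | ∀ i, f i ∈ (y : ProjectiveSpectrum (MvPolynomial.homogeneousSubmodule (Fin (3 + 1)) K)).asHomogeneousIdeal}) ∧ (∀ y ∈ {y : (Literature.AlgebraicGeometry.Motives.projectiveSpace 3 K).left | ∀ i, f i ∈ (y : ProjectiveSpectrum (MvPolynomial.homogeneousSubmodule (Fin (3 + 1)) K)).asHomogeneousIdeal}, ∃ e : Fin c ↪ Fin (3 + 1), Matrix.det (Matrix.of fun i j => MvPolynomial.pderiv (e j) (f i)) ∉ (y : ProjectiveSpectrum (MvPolynomial.homogeneousSubmodule (Fin (3 + 1)) K)).asHomogeneousIdeal) ∧ ∃ (hSig : IsClosed {y : (Literature.AlgebraicGeometry.Motives.projectiveSpace 3 K).left | ∀ i, f i ∈ (y : ProjectiveSpectrum (MvPolynomial.homogeneousSubmodule (Fin (3 + 1)) K)).asHomogeneousIdeal}) (F₂ : AlgebraicGeometry.Scheme.{0}) (υ : F₂ ⟶ (Literature.AlgebraicGeometry.Motives.projectiveSpace 3 K).left), Literature.AlgebraicGeometry.Resolution.IsBlowup υ (AlgebraicGeometry.Scheme.IdealSheafData.vanishingIdeal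 (⟨{y : (Literature.AlgebraicGeometry.Motives.projectiveSpace 3 K).left | ∀ i, f i ∈ (y : ProjectiveSpectrum (MvPolynomial.homogeneousSubmodule (Fin (3 + 1)) K)).asHomogeneousIdeal}, hSig⟩ : TopologicalSpace.Closeds (Literature.AlgebraicGeometry.Motives.projectiveSpace 3 K).left)) ∧ ∃ (F' : AlgebraicGeometry.Scheme.{0}) (ρ' : F' ⟶ F₂) (T' : Set F'), (∀ Q : (∀ F₁ : AlgebraicGeometry.Scheme.{0}, (F₁ ⟶ F₂) → Set F₁ → Prop), Q F₂ (CategoryTheory.CategoryStruct.id F₂) (closure (υ ⁻¹' (Set.range (Literature.AlgebraicGeometry.Motives.SmoothHypersurface.hypersurfaceι (WhitneyCubic.form K)).left \ {y : (Literature.AlgebraicGeometry.Motives.projectiveSpace 3 K).left | ∀ i, f i ∈ (y : ProjectiveSpectrum (MvPolynomial.homogeneousSubmodule (Fin (3 + 1)) K)).asHomogeneousIdeal}))) → (∀ (F₁ F₃ : AlgebraicGeometry.Scheme.{0}) (ρ : F₁ ⟶ F₂) (T₁ : Set F₁) (x : ↥((AlgebraicGeometry.Scheme.IdealSheafData.vanishingIdeal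 (⟨closure T₁, isClosed_closure⟩ : TopologicalSpace.Closeds F₁))).subscheme) (υ₁ : F₃ ⟶ F₁) (hx : IsClosed ({(((AlgebraicGeometry.Scheme.IdealSheafData.vanishingIdeal (⟨closure T₁, isClosed_closure⟩ : TopologicalSpace.Closeds F₁))).subschemeι x : F₁)} : Set F₁)), Q F₁ ρ T₁ → ¬ IsRegularLocalRing (((AlgebraicGeometry.Scheme.IdealSheafData.vanishingIdeal (⟨closure T₁, isClosed_closure⟩ : TopologicalSpace.Closeds F₁))).subscheme.presheaf.stalk x) → Literature.AlgebraicGeometry.Resolution.IsBlowup υ₁ (AlgebraicGeometry.Scheme.IdealSheafData.vanishingIdeal (⟨{(((AlgebraicGeometry.Scheme.IdealSheafData.vanishingIdeal (⟨closure T₁, isClosed_closure⟩ : TopologicalSpace.Closeds F₁))).subschemeι x : F₁)}, hx⟩ : TopologicalSpace.Closeds F₁)) → Q F₃ (CategoryTheory.CategoryStruct.comp υ₁ ρ) (closure (υ₁ ⁻¹' (T₁ \ {(((AlgebraicGeometry.Scheme.IdealSheafData.vanishingIdeal (⟨closure T₁, isClosed_closure⟩ : TopologicalSpace.Closeds F₁))).subschemeι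 x : F₁)})))) → Q F' ρ' T') ∧ Literature.AlgebraicGeometry.Resolution.Scheme.IsRegular (AlgebraicGeometry.Scheme.IdealSheafData.vanishingIdeal (⟨closure T', isClosed_closure⟩ : TopologicalSpace.Closeds F')).subscheme) := by
  classical
  obtain ⟨fk, hfk', hfkC, hfkX⟩ := EquisingularLift.StrataSplit.LinearCentre.exists_kill K 1 2
  haveI := isIntegral_hypersurface K
  haveI : IsLocallyNoetherian (Literature.AlgebraicGeometry.Motives.projectiveSpace (2 + 1) K).left :=
    EquisingularLift.StrataSplit.LinearCentre.isLocallyNoetherian_proj K (1 + 2)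
  -- the blow-up of `ℙ³_k` along `Λ = ker Proj(f_k) = 𝓘(Σ)`
  obtain ⟨F₂, υ, hυ⟩ := exists_isBlowup (Proj (homogeneousSubmodule (Fin (1 + 2 + 1)) K)) (Proj.map fk hfk').ker
  have hΛ := ker_projMap_kill_eq_vanishingIdeal_doubleLine K fk hfk' hfkC hfkX (isClosed_doubleLine K)
  have hsupp := support_ker_projMap_kill_eq_doubleLine K fk hfk' hfkC hfkX
  -- the reduced strict transform is regular (zero point steps)
  have hreg : Scheme.IsRegular (vanishingIdeal (⟨closure (υ ⁻¹' (Set.range (hypersurfaceι (form K)).left \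
      ((Proj.map fk hfk').ker.support : Set (Proj (homogeneousSubmodule (Fin (1 + 2 + 1)) K))))), isClosed_closure⟩ :
      Closeds F₂)).subscheme :=
    EquisingularLift.StrataSplit.LinearCentre.isRegular_reducedStrictTransform_of_blowupModel (hypersurfaceι (form K)).left
      (Proj.map fk hfk').ker (not_range_subset_support K fk hfk' hfkC hfkX)
      (fun Z ρ hρ => isRegular_of_isBlowup_comap K fk hfk' hfkC hfkX Z ρ hρ) υ hυ
  refine ⟨2, ![X 2, X 3], ![1, 1], ?_, ⟨_, genericPoint_mem_doubleLine K⟩, doubleLine_subset_range_ι K,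
    not_range_ι_subset_doubleLine K, fun y _ => jacobian_clause_doubleLine K y, isClosed_doubleLine K, F₂, υ, ?_, F₂, 𝟙 F₂, _,
    fun Q h0 _ => h0, ?_⟩
  · intro i
    fin_cases i <;> exact ⟨le_rfl, (mem_homogeneousSubmodule _ _).mpr (isHomogeneous_X K _)⟩
  · rw [← hΛ]
    exact hυ
  · rw [hsupp] at hreg
    have e : (⟨closure (closure (υ ⁻¹' (Set.range (hypersurfaceι (form K)).left \
        {y : (Literature.AlgebraicGeometry.Motives.projectiveSpace 3 K).left |
      ∀ i, (![X 2, X 3] : Fin 2 → MvPolynomial (Fin (3 + 1)) K) i ∈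
        (y : ProjectiveSpectrum (MvPolynomial.homogeneousSubmodule (Fin (3 + 1)) K)).asHomogeneousIdeal}))),
        isClosed_closure⟩ : Closeds F₂) = ⟨closure (υ ⁻¹' (Set.range (hypersurfaceι (form K)).left \
        {y : (Literature.AlgebraicGeometry.Motives.projectiveSpace 3 K).left |
      ∀ i, (![X 2, X 3] : Fin 2 → MvPolynomial (Fin (3 + 1)) K) i ∈
        (y : ProjectiveSpectrum (MvPolynomial.homogeneousSubmodule (Fin (3 + 1)) K)).asHomogeneousIdeal})),
        isClosed_closure⟩ := Closeds.ext closure_closure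
    have hreg' : Scheme.IsRegular (vanishingIdeal (⟨closure (closure (υ ⁻¹' (Set.range (hypersurfaceι (form K)).left \
        {y : (Literature.AlgebraicGeometry.Motives.projectiveSpace 3 K).left |
      ∀ i, (![X 2, X 3] : Fin 2 → MvPolynomial (Fin (3 + 1)) K) i ∈
        (y : ProjectiveSpectrum (MvPolynomial.homogeneousSubmodule (Fin (3 + 1)) K)).asHomogeneousIdeal}))),
        isClosed_closure⟩ : Closeds F₂)).subscheme := by
      rw [e]
      exact hreg
    exact hreg'

end WhitneyCubic

end Summit.ResolutionOfSingularities.ResolutionOfSingularities.Cruxes.EquisingularLiftNat.Sections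

end
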